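import Mathlib
import Literature.Probability.RandomPlanarGeometry.ChordalBoundary
import Literature.Probability.RandomPlanarGeometry.ConformalMapCaratheodoryProofs
import Literature.Probability.RandomPlanarGeometry.CaratheodoryHalfPlaneProofs

/-!
# Welding rigidity, I: boundary correspondence facts and the transition map of two uniformisers

Support file for item `stmt-CriticalPhenomena-4505` (`WeldingRigidity`, route
`SAWWeldingIdentification`): a removable simple chord of a four-marked Jordan domain is determined
by its conformal welding. The proof builds the self-map `F = φ' ∘ φ⁻¹` on the left bank,
`ψ' ∘ ψ⁻¹` on the right bank, glued along the chord; this file supplies the one-bank brick.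

For Jordan domains `J, J'` uniformised by `φ : ℍₒ → J`, `φ' : ℍₒ → J'` (the tree's
`ConformalEquiv`), Carathéodory's theorem (PROVED in the tree:
`JordanDomain.exists_continuousOn_extension_holds`, Pommerenke 1992 Thm. 2.6) gives disc extensions
`Φ, Φ'` (homeomorphisms of the closed disc onto the closures). We record:

* elementary boundary-correspondence facts for `x ↦ φ.boundaryExtension x` on the real line
  (injective, continuous, lands on `∂J`, misses the value at `∞`, hits every other boundary
  point);
* `exists_transition` — the **transition map** `T = Φ' ∘ Φ⁻¹`: continuous on `closure J`, equal
  to `φ' ∘ φ⁻¹` on `J`, carrying `φ.boundaryExtension x` to `φ'.boundaryExtension x` for every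
  real `x` and the boundary value of `φ` at `∞` to that of `φ'`.

All folklore (Pommerenke 1992, §2.3). No new definitions.
-/

noncomputable section

open Set Filter Metric Topology Complex
open UpperHalfPlane (upperHalfPlaneSet)

namespace Summit.CriticalPhenomena.SAWScalingLimit.Theorems.WeldingRigidity

open Literature.Probability.RandomPlanarGeometry
open Literature.Probability.RandomPlanarGeometry.JordanDomain

variable {J : JordanDomain} (φ : ConformalEquiv upperHalfPlaneSet J.carrier)

/-- The boundary correspondence `x ↦ φ.boundaryExtension x` of a uniformiser of a Jordan domain
is injective on the real line (Carathéodory: the disc extension is injective on the closed disc,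
and the Cayley transform is injective on `ℝ`). [folklore] -/
theorem boundaryExtension_ofReal_injective :
    Function.Injective fun x : ℝ => φ.boundaryExtension x := by
  obtain ⟨Φ, hΦ⟩ := exists_isDiscExtension exists_continuousOn_extension_holds φ
  intro x y hxy
  simp only at hxy
  rw [hΦ.boundaryExtension_eq (by simp), hΦ.boundaryExtension_eq (by simp)] at hxy
  have hmem : ∀ t : ℝ, cayleyFun (t : ℂ) ∈ closedBall (0 : ℂ) 1 := fun t =>
    mem_closedBall_zero_iff.2 (norm_cayleyFun_ofReal t).le
  have h1 : cayleyFun (x : ℂ) = cayleyFun (y : ℂ) := hΦ.bijOn.injOn (hmem x) (hmem y) hxy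
  have h2 := congrArg cayleyInvFun h1
  rw [cayleyInvFun_cayleyFun (add_I_ne_zero (by simp)),
    cayleyInvFun_cayleyFun (add_I_ne_zero (by simp))] at h2
  exact_mod_cast h2

/-- The boundary correspondence is continuous on the real line (Carathéodory: the boundary
extension is continuous on the closed half-plane). [folklore] -/
theorem continuous_boundaryExtension_ofReal :
    Continuous fun x : ℝ => φ.boundaryExtension x := by
  have h := continuousOn_boundaryExtension_holds J φ
  refine h.comp_continuous continuous_ofReal fun x => ?_
  exact mem_closure_upperHalfPlaneSet_iff.2 (by simp)

/-- Real points are sent to the frontier of the domain. [folklore] -/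
theorem boundaryExtension_ofReal_mem_frontier' (x : ℝ) :
    φ.boundaryExtension x ∈ frontier J.carrier := by
  obtain ⟨Φ, hΦ⟩ := exists_isDiscExtension exists_continuousOn_extension_holds φ
  exact hΦ.boundaryExtension_ofReal_mem_frontier x

/-- Real points are not sent into the (open) domain. [folklore] -/
theorem boundaryExtension_ofReal_notMem (x : ℝ) : φ.boundaryExtension x ∉ J.carrier := fun h =>
  J.notMem_frontier_of_mem h (boundaryExtension_ofReal_mem_frontier' φ x)

/-- The boundary extension at a real point with a boundary value is that value. [folklore] -/
theorem boundaryExtension_ofReal_eq_of_hasBoundaryValue {x : ℝ} {p : ℂ}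
    (h : φ.HasBoundaryValue x p) : φ.boundaryExtension x = p :=
  boundaryExtension_eq_of_hasBoundaryValue' φ (by simp) h

/-- The boundary extension at `0` is the boundary value at `0`. [folklore] -/
theorem boundaryExtension_zero_eq {a : ℂ} (h : φ.HasBoundaryValue 0 a) :
    φ.boundaryExtension ((0 : ℝ) : ℂ) = a :=
  boundaryExtension_ofReal_eq_of_hasBoundaryValue φ (by rwa [ofReal_zero])

/-- No real point is sent to the boundary value at infinity. [folklore] -/
theorem boundaryExtension_ofReal_ne_of_atInfty {b : ℂ} (hb : φ.HasBoundaryValueAtInfty b)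
    (x : ℝ) : φ.boundaryExtension x ≠ b := by
  obtain ⟨Φ, hΦ⟩ := exists_isDiscExtension exists_continuousOn_extension_holds φ
  rw [← hΦ.apply_one_eq hb]
  exact hΦ.boundaryExtension_ofReal_ne x

/-- A real point other than `0` is not sent to the boundary value at `0`. [folklore] -/
theorem boundaryExtension_ofReal_ne_of_ne_zero {a : ℂ} (h : φ.HasBoundaryValue 0 a) {x : ℝ}
    (hx : x ≠ 0) : φ.boundaryExtension x ≠ a := by
  rw [← boundaryExtension_zero_eq φ h]
  exact fun heq => hx (boundaryExtension_ofReal_injective φ heq)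

/-- **Every boundary point other than the value at infinity is attained on the real line**
(Carathéodory's boundary correspondence, `JordanDomain.existsUnique_real_or_infty_holds`).
[folklore] -/
theorem exists_boundaryExtension_ofReal_eq {b : ℂ} (hb : φ.HasBoundaryValueAtInfty b) {z : ℂ}
    (hz : z ∈ frontier J.carrier) (hzb : z ≠ b) : ∃ x : ℝ, φ.boundaryExtension x = z := by
  rcases existsUnique_real_or_infty_holds J φ hz with ⟨x, hx, -⟩ | hinf
  · exact ⟨x, boundaryExtension_ofReal_eq_of_hasBoundaryValue φ hx⟩
  · haveI := neBot_cocompact_inf_principal_upperHalfPlaneSet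
    exact absurd (tendsto_nhds_unique hinf hb) hzb

/-- **The transition map of two uniformised Jordan domains.** For `φ : ℍₒ → J` and
`φ' : ℍₒ → J'` there is a map `T` (namely `Φ' ∘ Φ⁻¹` for the Carathéodory disc extensions),
continuous on `closure J` with values in `closure J'`, equal to `φ' ∘ φ⁻¹` on `J`, carrying the
boundary point `φ.boundaryExtension x` to `φ'.boundaryExtension x` for every real `x`, and the
boundary value of `φ` at `∞` to that of `φ'`. (Pommerenke 1992, §2.3: `f* ∘ f⁻¹`.) [folklore] -/
theorem exists_transition (J J' : JordanDomain) (φ : ConformalEquiv upperHalfPlaneSet J.carrier)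
    (φ' : ConformalEquiv upperHalfPlaneSet J'.carrier) :
    ∃ T : ℂ → ℂ, ContinuousOn T (closure J.carrier) ∧
      MapsTo T (closure J.carrier) (closure J'.carrier) ∧
      EqOn T (fun w => φ' (φ.symm w)) J.carrier ∧
      (∀ x : ℝ, T (φ.boundaryExtension x) = φ'.boundaryExtension x) ∧
      (∀ q q' : ℂ, φ.HasBoundaryValueAtInfty q → φ'.HasBoundaryValueAtInfty q' → T q = q') := by
  obtain ⟨Φ, hΦ⟩ := exists_isDiscExtension exists_continuousOn_extension_holds φ
  obtain ⟨Φ', hΦ'⟩ := exists_isDiscExtension exists_continuousOn_extension_holds φ'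
  set g : ℂ → ℂ := Function.invFunOn Φ (closedBall 0 1) with hg
  have hginv : ∀ ζ ∈ closedBall (0 : ℂ) 1, g (Φ ζ) = ζ := fun ζ hζ =>
    hΦ.bijOn.injOn.leftInvOn_invFunOn hζ
  have hgmaps : MapsTo g (closure J.carrier) (closedBall 0 1) :=
    hΦ.bijOn.surjOn.mapsTo_invFunOn
  have hgcont : ContinuousOn g (closure J.carrier) := by
    rw [← hΦ.bijOn.image_eq]
    exact IsCompact.continuousOn_invFunOn (isCompact_closedBall 0 1) hΦ.continuousOn
      hΦ.bijOn.injOn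
  refine ⟨Φ' ∘ g, hΦ'.continuousOn.comp hgcont hgmaps,
    fun w hw => hΦ'.bijOn.mapsTo (hgmaps hw), ?_, ?_, ?_⟩
  · intro w hw
    have hw' : φ.symm w ∈ upperHalfPlaneSet := φ.symm_mapsTo hw
    have hζ : cayleyFun (φ.symm w) ∈ ball (0 : ℂ) 1 := cayley.mapsTo hw'
    have h1 : g w = cayleyFun (φ.symm w) := by
      conv_lhs => rw [← apply_cayleyFun_symm φ hΦ.eqOn hw]
      exact hginv _ (ball_subset_closedBall hζ)
    simp only [Function.comp_apply]
    rw [h1, hΦ'.eqOn hζ, ConformalEquiv.trans_apply, cayley_symm_apply,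
      cayleyInvFun_cayleyFun (add_I_ne_zero (le_of_lt hw'))]
  · intro x
    have hζ : cayleyFun (x : ℂ) ∈ closedBall (0 : ℂ) 1 :=
      mem_closedBall_zero_iff.2 (norm_cayleyFun_ofReal x).le
    simp only [Function.comp_apply]
    rw [hΦ.boundaryExtension_eq (by simp), hginv _ hζ, hΦ'.boundaryExtension_eq (by simp)]
  · intro q q' hq hq'
    simp only [Function.comp_apply]
    rw [← hΦ.apply_one_eq hq, hginv 1 (by simp), hΦ'.apply_one_eq hq']

end Summit.CriticalPhenomena.SAWScalingLimit.Theorems.WeldingRigidity
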